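import Literature.AlgebraicGeometry.Motives.AbelianVarietyProjectiveChart
import Literature.AlgebraicGeometry.Motives.AlgPointsProductProofs
import Literature.AlgebraicGeometry.Motives.ComplexPointsManifold
import Literature.AlgebraicGeometry.Motives.BettiRealization
import Literature.AlgebraicGeometry.Motives.SubschemeCycles
import Literature.AlgebraicGeometry.HodgeTheory.TopDegreeClasses
import Literature.AlgebraicTopology.SingularHomology.CohomologyHomotopyInvariance
import Literature.AlgebraicTopology.SingularHomology.HOneProducts
import HarnessLib

/-!
# The complex points of an abelian variety: a compact connected topological group

For a group scheme `G` over a field `k` and a Hausdorff topological field `L ⊇ k`, the group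
`G(L) = Hom_k(Spec L, G)` (Mathlib's scoped `Hom.group`: `P · Q = ⟨P, Q⟩ ≫ μ`, `P⁻¹ = P ≫ ι`) is a
**topological group** for the strong topology of `Literature.AlgebraicGeometry.Motives.AlgPoints`:
the group law `G(L) × G(L) = (G ×ₖ G)(L) → G(L)` and the inversion are induced by morphisms of
schemes, hence continuous (`AlgPoints.continuous_map`), the identification
`(G ×ₖ G)(L) ≃ₜ G(L) × G(L)` being the tree's PROVED `AlgPoints.isHomeomorph_prodEquiv_holds`
(Mumford, *Abelian Varieties*, §1 (1): "a compact complex-analytic manifold with an (analytic)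
group structure"; Conrad, *Weil and Grothendieck approaches to adelic points*, Prop. 2.1 / 3.1:
the topology on `X(L)` is functorial and compatible with fibre products, so `G(L)` is a
topological group).

For an abelian variety `A` over `ℂ`, `A(ℂ)` is moreover **compact** (`A` proper: Mumford,
*Red Book* I.10 Thm. 2, the tree's `compactSpace_algPoints_of_isProper_holds`), **Hausdorff**
(`A` separated, `ComplexPoints.t2Space_of_isSeparated`), **connected** (`A` is smooth projective
and geometrically irreducible — the tree's PROVED `AbelianVariety.isSmoothProjective_holds` — and
irreducible varieties have connected complex points, SGA1 XII Prop. 2.4, the tree's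
`HodgeTheory.connectedSpace_complexPoints`) and **path connected** (a connected topological
manifold, by the algebraic charts of `ComplexPoints.chartedSpace`): "a compact connected complex
Lie group" (Mumford §1 (1); Milne, *Abelian Varieties*, §2 before Thm. 2.1).

Consequence used for the Jacobian (`Literature/AlgebraicGeometry/Motives/Jacobian.lean`, named fact
`isIso_bettiCohomology_map_abelJacobi`): **translations act trivially on Betti cohomology**. For a
morphism `f : X → A` of `ℂ`-schemes and a point `a ∈ A(ℂ)`, the translate `x ↦ f(x) · a` induces the
same map `Hⁱ(A(ℂ); ℚ) → Hⁱ(X(ℂ); ℚ)` as `f`, because right translation by `a` is homotopic to the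
identity in the path-connected group `A(ℂ)` (the tree's `ContinuousMap.homotopic_mulRight_id`) and
singular cohomology is homotopy invariant (Hatcher, *Algebraic Topology*, §3.1 p. 201, the tree's
PROVED `singularCohomology.map_eq_of_homotopic'`). Everything here is proved; no new definitions.

## Main results

* `AlgPoints.continuous_mul`, `AlgPoints.continuous_inv`, `AlgPoints.isTopologicalGroup`
  (any group scheme, any Hausdorff topological field); instance
  `AbelianVariety.Points.instIsTopologicalGroup`.
* `AbelianVariety.Points.instCompactSpace`, `instT2Space`, `instConnectedSpace`,
  `instLocallyPathConnectedSpace`, `instPathConnectedSpace` for `A : AbelianVariety ℂ`.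
* `AbelianVariety.mapContinuous_mul_const`, `AbelianVariety.bettiCohomology_map_mul_const`,
  `AbelianVariety.bettiCohomology_map_const_mul`: translates of `f` act as `f` on `Hⁱ(-(ℂ); ℚ)`.

## References

* D. Mumford, *Abelian Varieties* (1970), §1 (1). [MumfordAV1970]
* B. Conrad, *Weil and Grothendieck approaches to adelic points*, Enseign. Math. 58 (2012),
  Prop. 2.1, Prop. 3.1. [ConradAdelicPoints2012]
* A. Grothendieck, M. Raynaud, *SGA 1*, Exp. XII Prop. 2.4. [SGA1]
* A. Hatcher, *Algebraic Topology* (2002), §3.1 p. 201. [HatcherAT2002]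
-/

noncomputable section

open CategoryTheory AlgebraicGeometry MonoidalCategory CartesianMonoidalCategory
open scoped MonObj

universe u

namespace Literature.AlgebraicGeometry.Motives

/-! ### `G(L)` is a topological group -/

namespace AlgPoints

section Group

variable {k : Type u} [Field k] {X G : SchemeOver k} [GrpObj G] {L : Type u} [Field L] [Algebra k L]

/-- A point followed by the structure morphism `X → Spec k` is the identity of `Spec k`
(a `k`-point of `Spec k` over `k` is the identity). [folklore] -/
@[reassoc]
theorem self_comp_toSpecOver (P : AlgPoints X k) : P ≫ toSpecOver X = 𝟙 _ := by
  apply Over.OverMorphism.ext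
  change P.left ≫ X.hom = 𝟙 (Spec (.of k))
  rw [Over.w P]
  simp only [specOver, Over.mk_hom, Algebra.algebraMap_self, CommRingCat.ofHom_id, Spec.map_id]

/-- `(f · g)(P) = f(P) · g(P)`: evaluation at an `L`-point is a group homomorphism
`Hom_k(X, G) → G(L)` (Mathlib `MonObj.comp_mul`). [folklore] -/
theorem map_mul (f g : X ⟶ G) (P : AlgPoints X L) : map (f * g) P = map f P * map g P :=
  MonObj.comp_mul P f g

/-- `(f⁻¹)(P) = f(P)⁻¹` (Mathlib `GrpObj.comp_inv`). [folklore] -/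
theorem map_inv (f : X ⟶ G) (P : AlgPoints X L) : map f⁻¹ P = (map f P)⁻¹ :=
  GrpObj.comp_inv P f

variable [TopologicalSpace L] [IsTopologicalDivisionRing L] [T1Space L]

/-- **The group law of `G(L)` is continuous** for a group scheme `G` over `k` and a topological
field `L` with `{0}` closed: `(P, Q) ↦ P · Q = ⟨P, Q⟩ ≫ μ` is `μ(L) ∘ prodEquiv⁻¹`, continuous by
`AlgPoints.continuous_map` and the tree's `AlgPoints.continuous_prodEquiv_symm` (Conrad 2012,
Prop. 2.1 / 3.1: functoriality and compatibility with fibre products). [cite: ConradAdelicPoints2012, Prop. 2.1 and Prop. 3.1] -/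
theorem continuous_mul : Continuous fun p : AlgPoints G L × AlgPoints G L ↦ p.1 * p.2 := by
  have h : (fun p : AlgPoints G L × AlgPoints G L ↦ p.1 * p.2) =
      map μ[G] ∘ (prodEquiv (X := G) (Y := G) (L := L)).symm := by
    funext p
    rfl
  rw [h]
  exact (continuous_map _).comp continuous_prodEquiv_symm

omit [IsTopologicalDivisionRing L] [T1Space L] in
/-- **Inversion on `G(L)` is continuous**: `P ↦ P⁻¹ = P ≫ ι` is `ι(L)`, continuous by
`AlgPoints.continuous_map` (Conrad 2012, Prop. 2.1: functoriality). [cite: ConradAdelicPoints2012, Prop. 2.1] -/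
theorem continuous_inv : Continuous fun P : AlgPoints G L ↦ P⁻¹ :=
  continuous_map ι[G]

/-- **`G(L)` is a topological group** for a group scheme `G` over `k` and a topological field `L`
with `{0}` closed (Conrad 2012, Prop. 2.1 / 3.1; for `L = ℂ` and `G` an abelian variety: Mumford,
*Abelian Varieties*, §1 (1)). Instance-shaped theorem for Mathlib's scoped group structure
`Hom.group` on `G(L) = Hom_k(Spec L, G)`; the instance is recorded on `AbelianVariety.Points`.
[cite: ConradAdelicPoints2012, Prop. 2.1 and Prop. 3.1] -/
theorem isTopologicalGroup : IsTopologicalGroup (AlgPoints G L) where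
  continuous_mul := continuous_mul
  continuous_inv := continuous_inv

end Group

end AlgPoints

namespace AbelianVariety

section TopologicalGroup

variable {k : Type u} [Field k] (A : AbelianVariety k) (L : Type u) [Field L] [Algebra k L]
  [TopologicalSpace L] [IsTopologicalDivisionRing L] [T1Space L]

/-- `A(L)` is a topological group for an abelian variety `A` over `k` and a topological field `L`
with `{0}` closed (Mumford, *Abelian Varieties*, §1 (1); Conrad 2012, Prop. 2.1 / 3.1):
`AlgPoints.isTopologicalGroup` for the group scheme `A.X`. [cite: MumfordAV1970, §1 (1)] -/
instance Points.instIsTopologicalGroup : IsTopologicalGroup (A.Points L) :=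
  AlgPoints.isTopologicalGroup

end TopologicalGroup

section Complex

variable (A : AbelianVariety ℂ)

/-- `A(ℂ)` is compact (`A` is proper over `ℂ`; Mumford, *Red Book*, I.10 Thm. 2, the tree's
`compactSpace_algPoints_of_isProper_holds`). [cite: MumfordRedBook1999, I.10 Thm. 2] -/
instance Points.instCompactSpace : CompactSpace (A.Points ℂ) :=
  compactSpace_algPoints_of_isProper_holds A.X ℂ

/-- `A(ℂ)` is Hausdorff (`A` is separated over `ℂ`; the tree's
`ComplexPoints.t2Space_of_isSeparated`). [cite: MumfordRedBook1999, I.10 Thm. 1] -/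
instance Points.instT2Space : T2Space (A.Points ℂ) :=
  ComplexPoints.t2Space_of_isSeparated A.X

/-- `A(ℂ)` is connected: `A` is smooth projective and geometrically irreducible
(`AbelianVariety.isSmoothProjective_holds`) and irreducible varieties have connected complex points
(SGA1 XII Prop. 2.4; the tree's `HodgeTheory.connectedSpace_complexPoints`). [cite: SGA1, Exp. XII Prop. 2.4] -/
instance Points.instConnectedSpace : ConnectedSpace (A.Points ℂ) :=
  Literature.AlgebraicGeometry.HodgeTheory.connectedSpace_complexPoints
    (AbelianVariety.isSmoothProjective_holds (A := A))

/-- `A(ℂ)` is locally path connected: it is a topological `2 dim A`-manifold (algebraic charts,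
Serre, GAGA §2 n°5–6; the tree's `IsSmoothProjective.chartedSpace`). [cite: SerreGAGA1956, §2 n°5 Prop. 2 and n°6] -/
instance Points.instLocallyPathConnectedSpace : LocallyPathConnectedSpace (A.Points ℂ) :=
  letI := (AbelianVariety.isSmoothProjective_holds (A := A)).chartedSpace
  ChartedSpace.locallyPathConnectedSpace (H := EuclideanSpace ℝ (Fin (2 * A.dim))) (M := A.Points ℂ)

/-- `A(ℂ)` is path connected ("a compact connected complex Lie group": Mumford, *Abelian
Varieties*, §1 (1)): connected and locally path connected. [cite: MumfordAV1970, §1 (1)] -/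
instance Points.instPathConnectedSpace : PathConnectedSpace (A.Points ℂ) :=
  pathConnectedSpace_iff_connectedSpace.2 inferInstance

end Complex

/-! ### Translations act trivially on Betti cohomology -/

section Translation

variable {A : AbelianVariety ℂ} {X : SchemeOver ℂ}

/-- On complex points, the right translate `f · a` of `f : X → A` by `a ∈ A(ℂ)` (the product of `f`
with the constant morphism `X → Spec ℂ → A` at `a`) is `f` followed by right translation by `a`.
[folklore] -/
theorem mapContinuous_mul_const (f : X ⟶ A.X) (a : A.Points ℂ) :
    AlgPoints.mapContinuous (L := ℂ) (f * (toSpecOver X ≫ a)) =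
      (⟨(· * a), continuous_mul_const a⟩ : C(A.Points ℂ, A.Points ℂ)).comp
        (AlgPoints.mapContinuous f) := by
  refine ContinuousMap.ext fun P ↦ ?_
  change P ≫ (f * (toSpecOver X ≫ a)) = (P ≫ f) * a
  rw [MonObj.comp_mul, AlgPoints.self_comp_toSpecOver_assoc]

/-- On complex points, the left translate `a · f` of `f : X → A` by `a ∈ A(ℂ)` is `f` followed by
left translation by `a`. [folklore] -/
theorem mapContinuous_const_mul (f : X ⟶ A.X) (a : A.Points ℂ) :
    AlgPoints.mapContinuous (L := ℂ) ((toSpecOver X ≫ a) * f) =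
      (⟨(a * ·), continuous_const_mul a⟩ : C(A.Points ℂ, A.Points ℂ)).comp
        (AlgPoints.mapContinuous f) := by
  refine ContinuousMap.ext fun P ↦ ?_
  change P ≫ ((toSpecOver X ≫ a) * f) = a * (P ≫ f)
  rw [MonObj.comp_mul, AlgPoints.self_comp_toSpecOver_assoc]

/-- **Translations act trivially on Betti cohomology.** For `f : X → A` and `a ∈ A(ℂ)`, the right
translate `f · a : X → A` induces the same map `Hⁱ(A(ℂ); ℚ) → Hⁱ(X(ℂ); ℚ)` as `f`: right
translation by `a` is homotopic to the identity of the path-connected topological group `A(ℂ)`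
(a path from `a` to `0`), and singular cohomology is homotopy invariant (Hatcher, §3.1 p. 201;
Mumford, *Abelian Varieties*, §1 (1)–(2) uses the same homotopy to see that `A(ℂ)` acts trivially
on its cohomology). [cite: HatcherAT2002, §3.1 p. 201] -/
theorem bettiCohomology_map_mul_const (f : X ⟶ A.X) (a : A.Points ℂ) (i : ℕ) :
    bettiCohomology.map (f * (toSpecOver X ≫ a)) i = bettiCohomology.map f i := by
  change Literature.AlgebraicTopology.SingularHomology.singularCohomology.map ℚ ℚ
      (AlgPoints.mapContinuous (L := ℂ) (f * (toSpecOver X ≫ a))) i = _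
  rw [mapContinuous_mul_const,
    Literature.AlgebraicTopology.SingularHomology.singularCohomology.map_comp,
    Literature.AlgebraicTopology.SingularHomology.singularCohomology.map_eq_of_homotopic' ℚ ℚ
      (Literature.AlgebraicTopology.SingularHomology.ContinuousMap.homotopic_mulRight_id a) i,
    Literature.AlgebraicTopology.SingularHomology.singularCohomology.map_id, Category.id_comp]

/-- **Translations act trivially on Betti cohomology** (left translates): `a · f` induces the same
map `Hⁱ(A(ℂ); ℚ) → Hⁱ(X(ℂ); ℚ)` as `f` (Hatcher, §3.1 p. 201; Mumford §1 (1)–(2)).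
[cite: HatcherAT2002, §3.1 p. 201] -/
theorem bettiCohomology_map_const_mul (f : X ⟶ A.X) (a : A.Points ℂ) (i : ℕ) :
    bettiCohomology.map ((toSpecOver X ≫ a) * f) i = bettiCohomology.map f i := by
  change Literature.AlgebraicTopology.SingularHomology.singularCohomology.map ℚ ℚ
      (AlgPoints.mapContinuous (L := ℂ) ((toSpecOver X ≫ a) * f)) i = _
  rw [mapContinuous_const_mul,
    Literature.AlgebraicTopology.SingularHomology.singularCohomology.map_comp,
    Literature.AlgebraicTopology.SingularHomology.singularCohomology.map_eq_of_homotopic' ℚ ℚ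
      (Literature.AlgebraicTopology.SingularHomology.ContinuousMap.homotopic_mulLeft_id a) i,
    Literature.AlgebraicTopology.SingularHomology.singularCohomology.map_id, Category.id_comp]

/-- A constant map `X → Spec ℂ → A` induces on `Hⁱ(A(ℂ); ℚ) → Hⁱ(X(ℂ); ℚ)` the same map as the
zero morphism `1 : X → A` (the translate of `1` by `a`). [cite: HatcherAT2002, §3.1 p. 201] -/
theorem bettiCohomology_map_toSpecOver_comp (a : A.Points ℂ) (i : ℕ) :
    bettiCohomology.map (toSpecOver X ≫ a) i = bettiCohomology.map (1 : X ⟶ A.X) i := by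
  rw [← bettiCohomology_map_mul_const (1 : X ⟶ A.X) a i, one_mul]

end Translation

end AbelianVariety

end Literature.AlgebraicGeometry.Motives

end
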